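import Mathlib
import HarnessLib
import Literature.Combinatorics.SimpleGraph.CliqueTree

/-!
# Clique trees are the maximum-weight spanning trees of the clique intersection graph
# (Blair–Peyton 1993, Thm 3.5; Bernstein–Goodman 1981)

Topic `Literature/Combinatorics/SimpleGraph`; a sequel to `CliqueTree` (rooted clique trees =
parent functions with the running intersection property, [FKMN01, §2.1]).  Source: J. R. S. Blair,
B. Peyton, *An introduction to chordal graphs and clique trees* [BP93], §3.2 (the induced-subtree
property, `𝒯^ist_G`; Thm 3.2: `𝒯^ist_G = 𝒯^ct_G`), §3.3 (Thm 3.4, Beeri–Fagin–Maier–Yannakakis: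
RIP parent trees are clique trees) and §3.4 (the weighted clique intersection graph `W_G`, pair
weights `|K ∩ K'|`; **Thm 3.5 (Bernstein–Goodman [BG81]): `𝒯^mst_G = 𝒯^ct_G`** — the clique trees
of a chordal graph are exactly the maximum-weight spanning trees of `W_G`).

Everything is stated for an arbitrary family `β : κ → Set V` ("the cliques", any index type) and a
simple graph `T` on `κ`; the chordal-graph corollaries index the maximal cliques by themselves.

## Main definitions

* `InducedSubtree β T` — for every `v`, the indices `memberSet β v = {k | v ∈ β k}` (`𝒦_G(v)`)
  induce a preconnected subgraph of `T` [BP93 §3.2].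
* `IsCliqueTree β T := T.IsTree ∧ InducedSubtree β T` (`𝒯^ist_G`) [BP93 §3.2].
* `interWeight β s(k, l) = |β k ∩ β l|`, `treeWeight β T = Σ_{e ∈ E(T)} interWeight β e` and
  `IsMaxWeightTree β T := T.IsTree ∧ ∀ T' tree, treeWeight β T' ≤ treeWeight β T` (`𝒯^mst_G`)
  [BP93 §3.4].
* `parentGraph par` — the underlying simple graph `k ∼ par k` of a parent function;
  `maxCliqueFamily G : {K // Maximal G.IsClique K} → Set V`.

## Main results

* **`isCliqueTree_iff_isMaxWeightTree`** — if SOME clique tree of `β` exists, a tree on `κ` is a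
  clique tree iff it is a maximum-weight tree [BP93 Thm 3.5]; the two inclusions
  `IsCliqueTree.isMaxWeightTree` (`𝒯^ct ⊆ 𝒯^mst`) and `IsMaxWeightTree.isCliqueTree`
  (`𝒯^mst ⊆ 𝒯^ct`, needs `𝒯^ct ≠ ∅` exactly as in [BP93, p. 18: "By Theorem 3.1, 𝒯^ct_G ≠ ∅"]).
* `TreeRunningIntersection.inducedSubtree_parentGraph`,
  `TreeRunningIntersection.exists_isCliqueTree`
  — a parent function with the running intersection property spans a clique tree
  [BP93 Thm 3.4 + Thm 3.2]; `parentGraph_isTree`; `TreeRunningIntersection.exists_single_root`.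
* `IsChordal.exists_isCliqueTree` — the maximal cliques of a finite chordal graph carry a clique
  tree [BP93 Thm 3.3 (Buneman, Gavril, Walter)]; **`IsChordal.isCliqueTree_iff_isMaxWeightTree`**
  — [BP93 Thm 3.5] for finite chordal graphs.

## Conventions and deviations

* PROOF ROUTE.  [BP93] prove Thm 3.5 with fundamental cut sets and the cycle characterisation of
  maximum spanning trees (Tarjan); the proof here is the counting argument — double counting
  `w(T) = Σ_v |E(T[𝒦(v)])|` (`treeWeight_eq_sum_natCard`), a forest on `m` vertices has at most
  `m - 1` edges with equality iff it is a tree (`natCard_edgeSet_le_of_isAcyclic`,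
  `natCard_edgeSet_eq_iff_preconnected`), hence `w(T) ≤ Σ_v (|𝒦(v)| - 1)` for every tree `T` with
  equality iff `T` has the induced-subtree property (`treeWeight_le_memberBound`,
  `treeWeight_eq_memberBound_iff`) — which gives both inclusions at once.  These steps are not
  statements of [BP93] and are kept `private` (folklore); only the published statements are public
  and carry `[cite: BlairPeyton1993, …]` tags.
* SPANNING TREES OF `W_G` vs TREES ON `𝒦_G`.  [BP93] take spanning trees of `W_G` (edges only
  between cliques that meet) of a CONNECTED chordal graph.  Here a "spanning tree" is any tree on
  the index type and a non-adjacent pair of `W_G` weighs `0`; no connectedness is assumed, and the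
  hypothesis `∃ T₀, IsCliqueTree β T₀` of the abstract theorem is discharged for every finite
  chordal graph (`IsChordal.exists_isCliqueTree`: the clique forest is made into one tree by
  hanging every root below the last index, where the parent function is unconstrained).  For a
  connected chordal graph the two readings of `𝒯^mst_G` agree (every maximum-weight tree is a
  clique tree, whose edges carry nonempty minimal separators [BP93 §4.1]); that remark is not
  formalised here.
* `Finite κ` / `Finite V` are assumed where sums occur (`treeWeight`, `memberBound`); the
  definitions are classical sums over `Fintype.ofFinite`, with `treeWeight_eq` / `memberBound_eq`
  rewriting them to honest `Finset` sums under `Fintype` instances.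
* Pages in the cite tags are the PDF pages of the held ORNL/TM-12203 report version of [BP93]
  (`paper:galaxy-pdf-524676218741277540`: §3.2 p. 14, Thm 3.3 p. 15, Thm 3.4 pp. 15–16, §3.4 and
  Thm 3.5 p. 17, its proof p. 18).

## References

* [BlairPeyton1993] J. R. S. Blair, B. Peyton, *An introduction to chordal graphs and clique
  trees*, in: Graph Theory and Sparse Matrix Computation, IMA Vol. Math. Appl. 56, Springer (1993)
  1–29; report ORNL/TM-12203 (1992).  doi:10.1007/978-1-4613-8369-7_1.
* [BG81] P. A. Bernstein, N. Goodman, *Power of natural semijoins*, SIAM J. Comput. 10 (1981)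
  751–771 ([BP93, ref. 2]; attribution only).
* [FukudaEtAl2001] M. Fukuda, M. Kojima, K. Murota, K. Nakata, *Exploiting sparsity in semidefinite
  programming via matrix completion I*, SIAM J. Optim. 11 (2001) 647–674, §2.1 (clique trees of the
  chordal extension; the consumer of `CliqueTree`).
-/

open SimpleGraph Finset

namespace Literature.Combinatorics.SimpleGraph

universe u v

variable {κ : Type v} {V : Type u}

/-! ### Forests: the edge count -/

section Forest

variable {W : Type*} {F : _root_.SimpleGraph W}

/-- An acyclic graph on a nonempty finite vertex type has at most `|W| - 1` edges … [folklore] -/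
private theorem natCard_edgeSet_add_one_le_of_isAcyclic [Finite W] [Nonempty W]
    (hF : F.IsAcyclic) :
    Nat.card F.edgeSet + 1 ≤ Nat.card W := by
  obtain ⟨T, hFT, -, hT⟩ :=
    (connected_top (V := W)).exists_isTree_le_of_le_of_isAcyclic le_top hF
  have hT' := (isTree_iff_connected_and_card.mp hT).2
  have hle : Nat.card F.edgeSet ≤ Nat.card T.edgeSet :=
    Nat.card_mono (Set.toFinite _) (edgeSet_mono hFT)
  omega

/-- … and exactly `|W| - 1` edges iff it is connected. [folklore] -/
private theorem natCard_edgeSet_add_one_eq_iff_connected [Finite W] [Nonempty W]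
    (hF : F.IsAcyclic) :
    Nat.card F.edgeSet + 1 = Nat.card W ↔ F.Connected := by
  refine ⟨fun hc => ?_, fun hc => (isTree_iff_connected_and_card.mp ⟨hc, hF⟩).2⟩
  obtain ⟨T, hFT, -, hT⟩ :=
    (connected_top (V := W)).exists_isTree_le_of_le_of_isAcyclic le_top hF
  have hT' := (isTree_iff_connected_and_card.mp hT).2
  have heq : F.edgeSet = T.edgeSet := by
    refine Set.eq_of_subset_of_ncard_le (edgeSet_mono hFT) ?_ (Set.toFinite _)
    change Nat.card T.edgeSet ≤ Nat.card F.edgeSet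
    omega
  rw [edgeSet_inj.mp heq]
  exact hT.connected

/-- The same without the nonemptiness hypothesis, with truncated subtraction: an acyclic graph on a
finite vertex type has at most `|W| - 1` edges … [folklore] -/
private theorem natCard_edgeSet_le_of_isAcyclic [Finite W] (hF : F.IsAcyclic) :
    Nat.card F.edgeSet ≤ Nat.card W - 1 := by
  cases isEmpty_or_nonempty W with
  | inl h =>
    have : IsEmpty F.edgeSet := ⟨fun e => h.false e.1.out.1⟩
    simp
  | inr h =>
    have := natCard_edgeSet_add_one_le_of_isAcyclic hF
    omega

/-- … with equality iff the graph is preconnected. [folklore] -/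
private theorem natCard_edgeSet_eq_iff_preconnected [Finite W] (hF : F.IsAcyclic) :
    Nat.card F.edgeSet = Nat.card W - 1 ↔ F.Preconnected := by
  cases isEmpty_or_nonempty W with
  | inl h =>
    have : IsEmpty F.edgeSet := ⟨fun e => h.false e.1.out.1⟩
    simp only [Nat.card_of_isEmpty, zero_le, Nat.sub_eq_zero_of_le, true_iff]
    exact fun u => h.elim u
  | inr h =>
    have h1 := natCard_edgeSet_add_one_le_of_isAcyclic hF
    have h2 := natCard_edgeSet_add_one_eq_iff_connected hF
    rw [connected_iff, and_iff_left h] at h2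
    constructor
    · intro h3; exact h2.mp (by omega)
    · intro h3; have := h2.mpr h3; omega

end Forest

/-! ### Weights in the clique intersection graph -/

section Weight

/-- The weight `|β k ∩ β l|` of the pair `{k, l}` in the weighted clique intersection graph `W_G`
of the family `β` [Blair–Peyton 1993, §3.4] (here on EVERY pair; a pair with empty intersection —
a non-edge of `W_G` — weighs `0`). [cite: BlairPeyton1993, §3.4 (p. 17)] -/
noncomputable def interWeight (β : κ → Set V) : Sym2 κ → ℕ :=
  Sym2.lift ⟨fun k l => (β k ∩ β l).ncard, fun k l => by dsimp only; rw [Set.inter_comm]⟩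

/-- The weight of the pair `{k, l}` is `|β k ∩ β l|`. [cite: BlairPeyton1993, §3.4 (p. 17)] -/
@[simp] theorem interWeight_mk (β : κ → Set V) (k l : κ) :
    interWeight β s(k, l) = (β k ∩ β l).ncard := rfl

/-- The indices of the members of the family containing `v` (`𝒦_G(v)` of [Blair–Peyton 1993,
§3.2] when `β` enumerates the maximal cliques). [cite: BlairPeyton1993, §3.2 (p. 14)] -/
def memberSet (β : κ → Set V) (v : V) : Set κ := {k | v ∈ β k}

/-- `k ∈ 𝒦(v) ↔ v ∈ β k`. [cite: BlairPeyton1993, §3.2 (p. 14)] -/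
@[simp] theorem mem_memberSet {β : κ → Set V} {v : V} {k : κ} : k ∈ memberSet β v ↔ v ∈ β k :=
  Iff.rfl

/-- THE INDUCED-SUBTREE PROPERTY of a graph `T` on the index set: for every `v`, the members
containing `v` induce a (pre)connected subgraph of `T` [Blair–Peyton 1993, §3.2: "for every
vertex `v`, the set `𝒦_G(v)` induces a subtree of `T`"; `T` itself need not be a tree here].
[cite: BlairPeyton1993, §3.2 (p. 14)] -/
def InducedSubtree (β : κ → Set V) (T : _root_.SimpleGraph κ) : Prop :=
  ∀ v, (T.induce (memberSet β v)).Preconnected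

/-- The weight `w(T) = Σ_{{k,l} ∈ E(T)} |β k ∩ β l|` of a graph `T` on the (finite) index set in
the weighted clique intersection graph [Blair–Peyton 1993, §3.4].
[cite: BlairPeyton1993, §3.4 (p. 17)] -/
noncomputable def treeWeight [Finite κ] (β : κ → Set V) (T : _root_.SimpleGraph κ) : ℕ := by
  classical exact (have _ := Fintype.ofFinite κ; ∑ e ∈ T.edgeFinset, interWeight β e)

/-- `w(T) = Σ_{e ∈ E(T)} |β k ∩ β l|` as an honest `Finset` sum under `Fintype` / decidability
instances. [cite: BlairPeyton1993, §3.4 (p. 17)] -/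
theorem treeWeight_eq [Fintype κ] [DecidableEq κ] (β : κ → Set V) (T : _root_.SimpleGraph κ)
    [DecidableRel T.Adj] : treeWeight β T = ∑ e ∈ T.edgeFinset, interWeight β e := by
  unfold treeWeight; congr!

/-- A CLIQUE TREE of the family `β`: a tree on the index set with the induced-subtree property —
the class `𝒯^ist_G` of [Blair–Peyton 1993, §3.2], equal to the clique trees `𝒯^ct_G` of §3.1
(clique-intersection property) by their Thm 3.2. [cite: BlairPeyton1993, §3.2 + Thm 3.2 (p. 14)] -/
def IsCliqueTree (β : κ → Set V) (T : _root_.SimpleGraph κ) : Prop :=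
  T.IsTree ∧ InducedSubtree β T

/-- A MAXIMUM-WEIGHT SPANNING TREE of the weighted clique intersection graph — the class
`𝒯^mst_G` of [Blair–Peyton 1993, §3.4], rendered as: a tree on the (finite) index set whose
weight no tree on the index set exceeds (zero-weight pairs allowed as edges; see the module
docstring for the comparison with spanning trees of `W_G` proper).
[cite: BlairPeyton1993, §3.4 (p. 17)] -/
def IsMaxWeightTree [Finite κ] (β : κ → Set V) (T : _root_.SimpleGraph κ) : Prop :=
  T.IsTree ∧ ∀ T' : _root_.SimpleGraph κ, T'.IsTree → treeWeight β T' ≤ treeWeight β T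

/-- DOUBLE COUNTING: the weight of `T` is the sum over the vertices `v` of the number of edges of
`T` joining two members containing `v` (the first step of the counting proof of Thm 3.5 used
here; not the argument of [Blair–Peyton 1993]). [folklore] -/
private theorem treeWeight_eq_sum_natCard [Finite κ] [Fintype V] (β : κ → Set V)
    (T : _root_.SimpleGraph κ) :
    treeWeight β T = ∑ v, Nat.card ((T.induce (memberSet β v)).edgeSet) := by
  classical
  have := Fintype.ofFinite κ
  have hv : ∀ v, Nat.card ((T.induce (memberSet β v)).edgeSet) =
      ∑ e ∈ T.edgeFinset, if ∀ k ∈ e, v ∈ β k then 1 else 0 := by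
    intro v
    rw [Nat.card_eq_fintype_card, ← edgeFinset_card, ← Finset.card_map
      (Function.Embedding.subtype (· ∈ memberSet β v)).sym2Map, map_edgeFinset_induce,
      ← Finset.card_filter]
    congr 1
    ext e
    simp only [Finset.mem_inter, Finset.mem_filter, Finset.mem_sym2_iff, Set.mem_toFinset,
      mem_memberSet]
  rw [treeWeight_eq]
  simp_rw [hv]
  rw [Finset.sum_comm]
  refine Finset.sum_congr rfl fun e _ => ?_
  induction e using Sym2.ind with
  | h k l =>
    rw [interWeight_mk, ← Finset.card_filter]
    have : β k ∩ β l = ↑(Finset.univ.filter fun v : V => ∀ j ∈ s(k, l), v ∈ β j) := by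
      ext v; simp
    rw [this, Set.ncard_coe_finset]

/-- The per-vertex bound `Σ_v (|𝒦(v)| - 1)` on the weight of a forest on the index set
(truncated subtraction; `V` finite). [folklore] -/
private noncomputable def memberBound [Finite V] (β : κ → Set V) : ℕ := by
  classical exact (have _ := Fintype.ofFinite V; ∑ v, ((memberSet β v).ncard - 1))

/-- `memberBound` as an honest `Finset` sum. [folklore] -/
private theorem memberBound_eq [Fintype V] (β : κ → Set V) :
    memberBound β = ∑ v, ((memberSet β v).ncard - 1) := by
  unfold memberBound; congr!

/-- THE COUNTING INEQUALITY: the weight of an acyclic graph `T` on the index set is at most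
`Σ_v (|𝒦(v)| - 1)` — each `𝒦(v)` induces a subforest of `T`, which has at most `|𝒦(v)| - 1`
edges. [folklore] -/
private theorem treeWeight_le_memberBound [Finite κ] [Finite V] (β : κ → Set V)
    {T : _root_.SimpleGraph κ} (hT : T.IsAcyclic) : treeWeight β T ≤ memberBound β := by
  have := Fintype.ofFinite V
  rw [treeWeight_eq_sum_natCard, memberBound_eq]
  exact Finset.sum_le_sum fun v _ => natCard_edgeSet_le_of_isAcyclic (hT.induce _)

/-- THE EQUALITY CASE: an acyclic `T` attains the bound `Σ_v (|𝒦(v)| - 1)` iff it has the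
induced-subtree property (termwise: a forest on `𝒦(v)` has exactly `|𝒦(v)| - 1` edges iff it is
connected). [folklore] -/
private theorem treeWeight_eq_memberBound_iff [Finite κ] [Finite V] (β : κ → Set V)
    {T : _root_.SimpleGraph κ} (hT : T.IsAcyclic) :
    treeWeight β T = memberBound β ↔ InducedSubtree β T := by
  have := Fintype.ofFinite V
  rw [treeWeight_eq_sum_natCard, memberBound_eq, Finset.sum_eq_sum_iff_of_le fun v _ => ?_]
  · simp only [Finset.mem_univ, forall_const, InducedSubtree]
    exact forall_congr' fun v => natCard_edgeSet_eq_iff_preconnected (hT.induce _)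
  · exact natCard_edgeSet_le_of_isAcyclic (hT.induce _)

/-- A clique tree has weight exactly `Σ_v (|𝒦(v)| - 1)`. [folklore] -/
private theorem IsCliqueTree.treeWeight_eq [Finite κ] [Finite V] {β : κ → Set V}
    {T : _root_.SimpleGraph κ}
    (h : IsCliqueTree β T) : treeWeight β T = memberBound β :=
  (treeWeight_eq_memberBound_iff β h.1.isAcyclic).mpr h.2

/-- **[BP93, Thm 3.5, `T^ct ⊆ T^mst`]**: every clique tree is a maximum-weight spanning tree of
the weighted clique intersection graph. [cite: BlairPeyton1993, Thm 3.5 (p. 18)] -/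
theorem IsCliqueTree.isMaxWeightTree [Finite κ] [Finite V] {β : κ → Set V}
    {T : _root_.SimpleGraph κ} (h : IsCliqueTree β T) : IsMaxWeightTree β T := by
  exact ⟨h.1, fun T' hT' => (treeWeight_le_memberBound β hT'.isAcyclic).trans h.treeWeight_eq.ge⟩

/-- **[BP93, Thm 3.5, `T^mst ⊆ T^ct`]**: once some clique tree exists, every maximum-weight
spanning tree of the weighted clique intersection graph is a clique tree.
[cite: BlairPeyton1993, Thm 3.5 (p. 18)] -/
theorem IsMaxWeightTree.isCliqueTree [Finite κ] [Finite V] {β : κ → Set V}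
    {T : _root_.SimpleGraph κ} (h : IsMaxWeightTree β T) (hex : ∃ T₀, IsCliqueTree β T₀) :
    IsCliqueTree β T := by
  obtain ⟨T₀, h₀⟩ := hex
  refine ⟨h.1, (treeWeight_eq_memberBound_iff β h.1.isAcyclic).mp (le_antisymm
    (treeWeight_le_memberBound β h.1.isAcyclic) ?_)⟩
  rw [← h₀.treeWeight_eq]
  exact h.2 T₀ h₀.1

/-- **[Blair–Peyton 1993, Thm 3.5 (Bernstein–Goodman 1981)]: CLIQUE TREES = MAXIMUM-WEIGHT
SPANNING TREES.**  If the family `β` has a clique tree (e.g. `β` enumerates the maximal cliques of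
a finite chordal graph, `IsChordal.exists_isCliqueTree`), then a tree on the index set is a clique
tree iff it is a maximum-weight spanning tree of the weighted clique intersection graph.
[cite: BlairPeyton1993, Thm 3.5 (p. 17)] -/
theorem isCliqueTree_iff_isMaxWeightTree [Finite κ] [Finite V] {β : κ → Set V}
    {T : _root_.SimpleGraph κ} (hex : ∃ T₀, IsCliqueTree β T₀) :
    IsCliqueTree β T ↔ IsMaxWeightTree β T :=
  ⟨IsCliqueTree.isMaxWeightTree, fun h => h.isCliqueTree hex⟩

end Weight

/-! ### Reindexing -/

section Reindex

variable {κ' : Type*}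

/-- The induced-subtree property is invariant under reindexing the family along a bijection.
[folklore] -/
private theorem InducedSubtree.comap {β : κ → Set V} {T : _root_.SimpleGraph κ}
    (h : InducedSubtree β T) (e : κ' ≃ κ) : InducedSubtree (β ∘ e) (T.comap e) := by
  intro v
  let f : (T.comap e).induce (memberSet (β ∘ e) v) ≃g T.induce (memberSet β v) :=
    { toEquiv := e.subtypeEquiv fun _ => Iff.rfl
      map_rel_iff' := Iff.rfl }
  exact f.preconnected_iff.mpr (h v)

/-- Clique trees are transported along a reindexing bijection. [folklore] -/
private theorem IsCliqueTree.comap {β : κ → Set V} {T : _root_.SimpleGraph κ}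
    (h : IsCliqueTree β T) (e : κ' ≃ κ) : IsCliqueTree (β ∘ e) (T.comap e) :=
  ⟨(Iso.comap e T).isTree_iff.mpr h.1, h.2.comap e⟩

end Reindex

/-! ### From a rooted clique tree (`TreeRunningIntersection`) to a clique tree -/

section Rooted

/-- The underlying simple graph of a parent function: `k ~ par k`, the loops at fixed points
discarded — the graph `T_rip` of [Blair–Peyton 1993, §3.3] "constructed by making each clique
adjacent to a parent clique". [cite: BlairPeyton1993, §3.3 (p. 15)] -/
def parentGraph (par : κ → κ) : _root_.SimpleGraph κ := SimpleGraph.fromRel fun k l => par k = l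

/-- Adjacency in the graph of a parent function. [cite: BlairPeyton1993, §3.3 (p. 15)] -/
theorem parentGraph_adj {par : κ → κ} {k l : κ} :
    (parentGraph par).Adj k l ↔ k ≠ l ∧ (par k = l ∨ par l = k) := Iff.rfl

/-- Climbing the parent chain inside the members containing `v`: if `v ∈ β (par^[i] k)` for all
`i ≤ t`, then `k` and `par^[t] k` are joined in the subgraph of `parentGraph par` induced on the
members containing `v`. [folklore] -/
private theorem reachable_induce_parentGraph_iterate {β : κ → Set V} {par : κ → κ} {v : V}
    {k : κ}
    (t : ℕ) (hall : ∀ i ≤ t, v ∈ β (par^[i] k)) :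
    ((parentGraph par).induce (memberSet β v)).Reachable ⟨k, hall 0 (Nat.zero_le _)⟩
      ⟨par^[t] k, hall t le_rfl⟩ := by
  induction t with
  | zero => exact Reachable.refl _
  | succ t ih =>
    have h1 := ih fun i hi => hall i (Nat.le_succ_of_le hi)
    refine h1.trans ?_
    by_cases hfix : par (par^[t] k) = par^[t] k
    · have : (⟨par^[t + 1] k, hall (t + 1) le_rfl⟩ : memberSet β v) =
          ⟨par^[t] k, hall t (Nat.le_succ t)⟩ := by
        apply Subtype.ext
        show par^[t + 1] k = par^[t] k
        rw [Function.iterate_succ_apply', hfix]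
      rw [this]
    · apply Adj.reachable
      rw [induce_adj, parentGraph_adj]
      refine ⟨fun h => hfix ?_, Or.inl ?_⟩
      · have h' : par^[t] k = par^[t + 1] k := h
        rw [Function.iterate_succ_apply'] at h'
        exact h'.symm
      · show par (par^[t] k) = par^[t + 1] k
        rw [Function.iterate_succ_apply']

variable [LinearOrder κ]

/-- **A RUNNING-INTERSECTION PARENT FUNCTION GIVES THE INDUCED-SUBTREE PROPERTY**: the underlying
graph of a rooted clique tree (`TreeRunningIntersection`, file `CliqueTree`: `k < par k` and
`β k ∩ β l ⊆ β (par k)` whenever `k < l` and the cliques meet) has the induced-subtree property —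
[Blair–Peyton 1993, Thm 3.4 (`𝒯^rip_G ⊆ 𝒯^ct_G`, Beeri–Fagin–Maier–Yannakakis) with Thm 3.2
(`𝒯^ct_G = 𝒯^ist_G`)], proved directly from the join tree property
`TreeRunningIntersection.exists_meet`. [cite: BlairPeyton1993, Thm 3.4 + Thm 3.2 (pp. 14–16)] -/
theorem TreeRunningIntersection.inducedSubtree_parentGraph [WellFoundedGT κ] {β : κ → Set V}
    {par : κ → κ} (h : TreeRunningIntersection β par) : InducedSubtree β (parentGraph par) := by
  rintro v ⟨k, hk⟩ ⟨l, hl⟩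
  obtain ⟨t, s, hmeet, hup, hdown⟩ := h.exists_meet hk hl
  have h1 := reachable_induce_parentGraph_iterate (β := β) t hup
  have h2 := reachable_induce_parentGraph_iterate (β := β) s hdown
  have hmid : (⟨par^[t] k, hup t le_rfl⟩ : memberSet β v) = ⟨par^[s] l, hdown s le_rfl⟩ :=
    Subtype.ext hmeet
  rw [hmid] at h1
  exact h1.trans h2.symm

/-- The graph of a parent function with a single fixed point `r` ("root") towards which every
other index climbs strictly (`k < p k`) is a tree — [Blair–Peyton 1993, §3.3]: an RIP-induced
parent function determines "a rooted tree" `T_rip` on the cliques.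
[cite: BlairPeyton1993, §3.3 (p. 15)] -/
theorem parentGraph_isTree [Finite κ] {p : κ → κ} {r : κ} (hr : p r = r)
    (hlt : ∀ k, k ≠ r → k < p k) : (parentGraph p).IsTree := by
  classical
  have := Fintype.ofFinite κ
  haveI : Nonempty κ := ⟨r⟩
  -- every index reaches the root
  have hreach : ∀ k, (parentGraph p).Reachable k r := by
    intro k
    induction k using WellFoundedGT.induction with
    | ind k ih =>
      by_cases hk : k = r
      · subst hk; exact Reachable.refl _
      · have hkp := hlt k hk
        exact (Adj.reachable (parentGraph_adj.mpr ⟨hkp.ne, Or.inl rfl⟩)).trans (ih (p k) hkp)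
  have hconn : (parentGraph p).Connected := ⟨fun a b => (hreach a).trans (hreach b).symm⟩
  rw [isTree_iff_connected_and_card]
  refine ⟨hconn, ?_⟩
  -- the edges are `{k, p k}`, `k ≠ r`, without repetition
  have hedges : (parentGraph p).edgeFinset = (Finset.univ.erase r).image fun k => s(k, p k) := by
    ext e
    induction e using Sym2.ind with
    | h a b =>
      simp only [mem_edgeFinset, mem_edgeSet, parentGraph_adj, Finset.mem_image, Finset.mem_erase,
        Finset.mem_univ, and_true, Sym2.eq_iff]
      constructor
      · rintro ⟨hab, h | h⟩
        · refine ⟨a, ?_, Or.inl ⟨rfl, h⟩⟩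
          rintro rfl
          exact hab (hr.symm.trans h)
        · refine ⟨b, ?_, Or.inr ⟨rfl, h⟩⟩
          rintro rfl
          exact hab (h.symm.trans hr)
      · rintro ⟨k, hk, ⟨rfl, h⟩ | ⟨rfl, h⟩⟩
        · exact ⟨fun hab => (hlt k hk).ne' (h.trans hab.symm), Or.inl h⟩
        · exact ⟨fun hab => (hlt k hk).ne' (h.trans hab), Or.inr h⟩
  have hinj : Set.InjOn (fun k => s(k, p k)) ↑(Finset.univ.erase r) := by
    intro k hk k' hk' hkk'
    simp only [Finset.coe_erase, Finset.coe_univ, Set.mem_sdiff, Set.mem_univ,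
      Set.mem_singleton_iff, true_and] at hk hk'
    rcases Sym2.eq_iff.mp hkk' with ⟨h, -⟩ | ⟨h1, h2⟩
    · exact h
    · exact absurd (((hlt k hk).trans_eq h2).trans ((hlt k' hk').trans_eq h1.symm)) (lt_irrefl k)
  rw [Nat.card_eq_fintype_card (α := κ), Nat.card_eq_fintype_card, ← edgeFinset_card, hedges,
    Finset.card_image_of_injOn hinj, Finset.card_erase_of_mem (Finset.mem_univ r),
    Finset.card_univ]
  have := Fintype.card_pos (α := κ)
  omega

/-- ONE ROOT SUFFICES: the parent function of a rooted clique tree on a nonempty finite index type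
may be modified at the indices whose clique meets no later clique (where it is unconstrained) so
that the largest index is the only fixed point and every other index climbs strictly — still a
rooted clique tree. [cite: FukudaEtAl2001, §2.1 (p. 652)] -/
theorem TreeRunningIntersection.exists_single_root [Finite κ] [Nonempty κ] {β : κ → Set V}
    {par : κ → κ} (h : TreeRunningIntersection β par) :
    ∃ (p : κ → κ) (r : κ), TreeRunningIntersection β p ∧ p r = r ∧ ∀ k, k ≠ r → k < p k := by
  classical
  have := Fintype.ofFinite κ
  refine ⟨fun k => if ∃ l, k < l ∧ (β k ∩ β l).Nonempty then par k
      else Finset.univ.max' Finset.univ_nonempty,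
    Finset.univ.max' Finset.univ_nonempty, ?_, ?_, ?_⟩
  · intro k l hkl hne
    have hex : ∃ l, k < l ∧ (β k ∩ β l).Nonempty := ⟨l, hkl, hne⟩
    simp only [hex, if_true]
    exact h hkl hne
  · have : ¬ ∃ l, Finset.univ.max' Finset.univ_nonempty < l ∧
        (β (Finset.univ.max' Finset.univ_nonempty) ∩ β l).Nonempty :=
      fun ⟨l, hl, _⟩ => absurd hl (not_lt.mpr (Finset.le_max' Finset.univ l (Finset.mem_univ l)))
    simp only [this, if_false]
  · intro k hk
    dsimp only
    split_ifs with hex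
    · obtain ⟨l, hkl, hne⟩ := hex
      exact (h hkl hne).1
    · exact lt_of_le_of_ne (Finset.le_max' _ k (Finset.mem_univ k)) hk

/-- **A ROOTED CLIQUE TREE YIELDS A CLIQUE TREE** (as a simple graph on a nonempty finite index
type: a tree with the induced-subtree property) [Blair–Peyton 1993, Thm 3.4 with Thm 3.2: an
RIP-induced parent function spans a clique tree].
[cite: BlairPeyton1993, Thm 3.4 + Thm 3.2 (pp. 14–16)] -/
theorem TreeRunningIntersection.exists_isCliqueTree [Finite κ] [Nonempty κ] {β : κ → Set V}
    {par : κ → κ} (h : TreeRunningIntersection β par) :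
    ∃ T : _root_.SimpleGraph κ, IsCliqueTree β T := by
  obtain ⟨p, r, hp, hr, hlt⟩ := h.exists_single_root
  exact ⟨parentGraph p, parentGraph_isTree hr hlt, hp.inducedSubtree_parentGraph⟩

end Rooted

/-! ### Chordal graphs -/

section Chordal

variable {G : _root_.SimpleGraph V}

/-- The maximal cliques `𝒦_G` of `G` as a family indexed by itself (the canonical vertex type
`{K // Maximal G.IsClique K}` of the clique intersection graph [Blair–Peyton 1993, §3.1]).
[cite: BlairPeyton1993, §3.1 (p. 11)] -/
abbrev maxCliqueFamily (G : _root_.SimpleGraph V) : {K : Set V // Maximal G.IsClique K} → Set V :=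
  fun K => K.1

/-- **THE MAXIMAL CLIQUES OF A FINITE CHORDAL GRAPH CARRY A CLIQUE TREE** [Blair–Peyton 1993,
Thm 3.3 (Buneman, Gavril, Walter), the "only if" half; via `IsChordal.exists_cliqueTree` of file
`CliqueTree` and Thm 3.4/3.2], indexed canonically by the maximal cliques themselves: a tree on
`{K // Maximal G.IsClique K}` with the induced-subtree property (no connectedness hypothesis: the
clique forests of the components are joined into one tree, see `exists_single_root`).
[cite: BlairPeyton1993, Thm 3.3 (p. 15)] -/
theorem IsChordal.exists_isCliqueTree [Finite V] (hG : IsChordal G) :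
    ∃ T : _root_.SimpleGraph {K : Set V // Maximal G.IsClique K},
      IsCliqueTree (maxCliqueFamily G) T := by
  obtain ⟨n, β, par, hinj, hmem, hpar, -⟩ := hG.exists_cliqueTree
  -- there is a maximal clique, hence an index
  obtain ⟨K, -, hK⟩ := Finite.exists_le_maximal (p := G.IsClique) (Set.pairwise_empty G.Adj)
  obtain ⟨k₀, -⟩ := (hmem K).mp hK
  haveI : Nonempty (Fin n) := ⟨k₀⟩
  obtain ⟨T, hT⟩ := hpar.exists_isCliqueTree
  -- reindex along the bijection `Fin n ≃ {K // Maximal G.IsClique K}` given by `β`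
  let f : Fin n → {K : Set V // Maximal G.IsClique K} := fun k => ⟨β k, (hmem (β k)).mpr ⟨k, rfl⟩⟩
  have hf : Function.Bijective f := by
    refine ⟨fun k l hkl => hinj (congrArg Subtype.val hkl), fun K => ?_⟩
    obtain ⟨k, hk⟩ := (hmem K.1).mp K.2
    exact ⟨k, Subtype.ext hk⟩
  let e : {K : Set V // Maximal G.IsClique K} ≃ Fin n := (Equiv.ofBijective f hf).symm
  have hβ : β ∘ e = maxCliqueFamily G :=
    funext fun K => congrArg Subtype.val (Equiv.ofBijective_apply_symm_apply f hf K)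
  exact ⟨T.comap e, hβ ▸ hT.comap e⟩

/-- **[Blair–Peyton 1993, Thm 3.5 (Bernstein–Goodman 1981)]: `𝒯^mst_G = 𝒯^ct_G`.**  For a finite
chordal graph, a tree on the set of maximal cliques is a clique tree iff it is a maximum-weight
spanning tree of the weighted clique intersection graph (pair weights `|K ∩ K'|`).
[cite: BlairPeyton1993, Thm 3.5 (p. 17)] -/
theorem IsChordal.isCliqueTree_iff_isMaxWeightTree [Finite V] (hG : IsChordal G)
    {T : _root_.SimpleGraph {K : Set V // Maximal G.IsClique K}} :
    IsCliqueTree (maxCliqueFamily G) T ↔ IsMaxWeightTree (maxCliqueFamily G) T :=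
  Literature.Combinatorics.SimpleGraph.isCliqueTree_iff_isMaxWeightTree hG.exists_isCliqueTree

end Chordal

end Literature.Combinatorics.SimpleGraph
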